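import Literature.MathematicalPhysics.QuantumFieldTheory.BalabanImbrieJaffe1984to88.BIJ88Sect3Statements

/-!
# `BalabanImbrieJaffe1984to88.BIJ88Sect3Expansion` — T. Bałaban, J. Imbrie, A. Jaffe, *Effective action and cluster
properties of the abelian Higgs model*, Commun. Math. Phys. **114** (1988) 257–315 [BalabanImbrieJaffe1988]: the first-step
expansions of Sect. 3 — the observable expansion (3.18) (PROVED), the large-field and local observable factors (3.20)–(3.21),
the small-field integral (3.38), its polymer form (3.39), the resummation (3.40) (PROVED) and the perturbative effective
action (3.41) — TYPED

statement-level skeleton of published theorems with citation tags; proofs where landed; nothing here is a claim about the Yang–Mills mass gap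

PDF held: `paper:balaban1988-cmp114-bij-abelian-higgs-effective-action` (journal page = PDF page + 256).  Renders read as
images (poppler ×3): PDF pp. 12, 15, 16 (journal 268, 271, 272).

CITATION HEADER (lean-in-tree rule).  Part of the lit-balaban TYPED SKELETON (HOME `run/shared/lean/pub/lit-balaban/`; rows
`C2.Eq3.18`, `C2.Eq3.20`, `C2.Eq3.21`, `C2.Eq3.38`, `C2.Eq3.39`, `C2.Eq3.40`, `C2.Eq3.41` of `HOME/lit-balaban-r18/ROWS-C2.md`; unit
`lit-balaban-r18`, gen 2).  WHAT IS REPRODUCED, verbatim, p. 268 [PDF 12]: *"We sum over these two terms for p ∈ π(F) ∩ Λ₀^{(0)**},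
where π(F) is the set of plaquettes having factors Re(ieε²)⁻¹(u(p) − 1) in F (with multiplicity). Denote by β(F), ξ(F) the bond,
sites having factors :\overline{φ}(b₋)u(b)φ(b₊):, or :|φ(x)|²: in F. The result is the following expansion for F:
F = Σ_{S_π ⊂ π(F)∩Λ₀^{(0)**}} Π_{p∈S_π} F_irr(p) Π_{p∈S_π^c} F_rel(p) Π_{p∈π(F)∖Λ₀^{(0)**}} Re(ieε²)⁻¹(u(p) − 1) Π_{b∈β(F)}
:\overline{φ}(b₋)u(b)φ(b₊): Π_{x∈ξ(F)} :|φ(x)|²:. (3.18) … We divide Λ₁₃^{(−1)c} into connected components {X_ω}, and define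
g₀(X_ω) = Σ_{S_π ⊂ π(F)∩Λ₀^{(0)**}∩X_ω^{**}} Σ_{S_p ⊂ Λ₀^{(0)**}∩X_ω^{**}} Π_{p∈S_π} F_irr(p) Π_{p∈S_π^c∩X_ω^{**}} F_rel(p)
Π_{p∈(π(F)∩X_ω^{**})∖Λ₀^{(0)**}} Re(ieε²)⁻¹(u(p) − 1) Π_{b∈β(F)∩X_ω^{*}} :\overline{φ}(b₋)u(b)φ(b₊): Π_{x∈ξ(F)∩X_ω} :|φ(x)|²:
Π_{p∈S_p}(e^{−W₀(p)} − 1) × exp[−Σ_{p∈X_ω^{**c}∖Λ₀^{(0)**}} e₀⁻²(1 − Re u(p)) − Σ_{x∈X_ω∖Λ₀^{(0)}} (P₀(φ(x)) + ½δm²ε²|φ(x)|² +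
E₁(x))]. (3.20) … F_{0,loc}(X_σ) = Π_{p∈X_σ^{**}∩π(F)} F_rel(p) Π_{b∈X_σ^{*}∩β(F)} :φ(b₋)u(b)φ(b₊): Π_{x∈X_σ∩ξ(F)} :|φ(x)|²:.
(3.21)"*; p. 271 [PDF 15]: *"The result is a small-field integral of the following form: ∫dμ^{(0)}_{Λ₁₀^{(0)}}(A^{(0)″}, φ^{(0)″})
χ′_{Λ₇^{(0)}} Π_{σ₁} F^{m̄}_{0,loc}(X_{σ₁}) exp[−V^{(0)}(Λ₈^{(0)}, u₁, A^{(0)}, φ^{(0)}) − Σ_X W₅^{(0)}(X)]. (3.38)"*; p. 272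
[PDF 16]: *"The cluster expansion puts the integral (3.38) in polymer form, e^{−V^{(0)}_{const}(Λ₈^{(0)})} Σ_{{X_α}} Π_α g₂(X_α).
(3.39) … The resummed integral in Λ₁₂^{(0)} is written as z_F(Λ₁₂^{(0)}) = (z_F(Λ₁₂^{(0)})/z(Λ₁₂^{(0)})) exp(log z(Λ₁₂^{(0)})). (3.40)
… The perturbative part of the effective action is 𝒫̃₁(Λ₁₂^{(0)}) = Σ_{α=1}^{n̄} −(1/α!)(d^α/dt^α) log z_t(Λ₁₂^{(0)})|_{t=0}, (3.41)
… As a result of these changes we have V^{(0)}_{const}(Λ₈^{(0)}) + 𝒫̃₁(Λ₁₂^{(0)}) = 𝒫^L_{1,loc}(Λ₈^{(0)}) + Σ_X W₆^{(0)″}(X). (3.41)"*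
(the label (3.41) is printed twice, p. 272).
TYPED READING.  (3.18) is an algebraic identity: the observable is the product of its factors, each plaquette factor inside
`Λ₀**` split as `F_rel + F_irr` ((3.17), `BIJ88Sect3Statements.eq317`); index the factors of `π(F)` (a multiset of plaquettes)
by a finite type `ι`, the region by a predicate `inΛ`, the remaining factors (`β(F)`, `ξ(F)`, `π(F)∖Λ₀**`) multiply through —
PROVED for every commutative ring (`eq318`).  (3.20), (3.21) are DEFINITIONS of the factors `g₀(X_ω)`, `F_{0,loc}(X_σ)` from the
component's index sets and the factor values (data: `F_irr`, `F_rel`, the unsplit plaquette factors, the Wick-ordered bond and site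
factors, `W₀`, the Wilson term `1 − Re u(p)`, the site terms of `𝒫_{0,loc}`); (3.38)/(3.39) are DEFINITIONS over an abstract
conditioned Gaussian measure `dμ_{Λ₁₀}` on the translated small fields and an abstract family of admissible polymer collections
`{X_α}`; (3.40) is the identity `z_F = (z_F/z)·e^{log z}` for `z > 0`, PROVED; (3.41) defines `𝒫̃₁` by `iteratedDeriv` of
`t ↦ log z_t` at `0` and the irrelevant remainder `Σ_X W₆^{(0)″}(X)` as the (3.41)(ii) difference.  NOT HERE: the cluster expansion
producing `g₂`, `W₅`, `W₆″` (Sects. 5–6, r16), the random walk expansions, any bound.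
-/

namespace Literature.MathematicalPhysics.QuantumFieldTheory.BalabanImbrieJaffe1984to88.BIJ88Sect3Expansion

open _root_.MeasureTheory
open scoped BigOperators
open Finset

noncomputable section

/-! ## (3.18): the expansion of the observable — PROVED -/

section Observable

variable {ι M : Type*} [CommRing M]

/-- **(3.18)** p. 268 [PDF 12] (verbatim in the module docstring) — PROVED as the algebra it is: if every plaquette factor of `F`
inside `Λ₀**` splits as `F_rel(p) + F_irr(p)` ((3.17)), then the product of the factors over `π(F)` (index type `ι`, "with
multiplicity"), times the remaining factors `rest` (the `β(F)`- and `ξ(F)`-products), equals the sum over `S_π ⊆ π(F) ∩ Λ₀**` of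
`Π_{S_π} F_irr · Π_{(π(F)∩Λ₀**)∖S_π} F_rel · Π_{π(F)∖Λ₀**} Re(ieε²)⁻¹(u(p) − 1) · rest`. [cite: BalabanImbrieJaffe1988, (3.18) p.268] -/
theorem eq318 [DecidableEq ι] (πF : Finset ι) (inΛ : ι → Prop) [DecidablePred inΛ] (Fp Frel Firr : ι → M)
    (h317 : ∀ i ∈ πF, inΛ i → Fp i = Frel i + Firr i) (rest : M) :
    (∏ i ∈ πF, Fp i) * rest =
      ∑ S ∈ (πF.filter inΛ).powerset,
        (∏ i ∈ S, Firr i) * (∏ i ∈ πF.filter inΛ \ S, Frel i) * (∏ i ∈ πF.filter (fun i => ¬ inΛ i), Fp i) * rest := by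
  have hsplit : ∏ i ∈ πF, Fp i = (∏ i ∈ πF.filter inΛ, Fp i) * ∏ i ∈ πF.filter (fun i => ¬ inΛ i), Fp i :=
    (prod_filter_mul_prod_filter_not πF inΛ Fp).symm
  have hin : ∏ i ∈ πF.filter inΛ, Fp i = ∏ i ∈ πF.filter inΛ, (Firr i + Frel i) := by
    refine prod_congr rfl fun i hi => ?_
    rw [mem_filter] at hi
    rw [h317 i hi.1 hi.2, add_comm]
  rw [hsplit, hin, prod_add, sum_mul, sum_mul]

/-- **(3.21)** p. 268 [PDF 12], verbatim: *"F_{0,loc}(X_σ) = Π_{p∈X_σ^{**}∩π(F)} F_rel(p) Π_{b∈X_σ^{*}∩β(F)} :φ(b₋)u(b)φ(b₊):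
Π_{x∈X_σ∩ξ(F)} :|φ(x)|²:. (3.21)"* — over the component's index sets (plaquette factors `πX`, bonds `βX`, sites `ξX`) and the
factor values (`Frel`, the Wick-ordered bond factors `Wb`, site factors `Vx`). [cite: BalabanImbrieJaffe1988, (3.21) p.268] -/
def F0loc {B X : Type*} (πX : Finset ι) (βX : Finset B) (ξX : Finset X) (Frel : ι → M) (Wb : B → M) (Vx : X → M) : M :=
  (∏ i ∈ πX, Frel i) * (∏ b ∈ βX, Wb b) * ∏ x ∈ ξX, Vx x

/-- (3.21) for a component meeting no factor of `F`: `F_{0,loc} = 1`. [cite: BalabanImbrieJaffe1988, (3.21) p.268] -/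
theorem F0loc_empty {B X : Type*} (Frel : ι → M) (Wb : B → M) (Vx : X → M) :
    F0loc (∅ : Finset ι) (∅ : Finset B) (∅ : Finset X) Frel Wb Vx = 1 := by
  simp [F0loc]

end Observable

/-- **(3.20)** p. 268 [PDF 12] (verbatim in the module docstring): the large-field factor `g₀(X_ω)` of a connected component
`X_ω` of `Λ₁₃^{(−1)c}` — the double sum over `S_π ⊆ π(F)∩Λ₀**∩X_ω**` (index set `πΛX`) and `S_p ⊆ Λ₀**∩X_ω**` (`SpDom`) of the
products of `F_irr` on `S_π`, `F_rel` on its complement, the unsplit factors `Re(ieε²)⁻¹(u(p)−1)` (`Fp`) on `(π(F)∩X_ω**)∖Λ₀**`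
(`πOut`), the Wick-ordered bond factors on `β(F)∩X_ω*` (`βX`, `Wb`), the site factors on `ξ(F)∩X_ω` (`ξX`, `Vx`), the Mayer
factors `e^{−W₀(p)} − 1` on `S_p`, times `exp[−Σ_{p} e₀⁻²(1 − Re u(p)) − Σ_{x} (P₀(φ(x)) + ½δm²ε²|φ(x)|² + E₁(x))]` over the
component's plaquettes resp. sites outside the small-field region (`PlOut`, printed `X_ω^{**c}∖Λ₀^{(0)**}` [sic]; `XOut = X_ω∖Λ₀`;
`wil p = 1 − Re u(p)`, `P0site x` = the site term). [cite: BalabanImbrieJaffe1988, (3.20) p.268] -/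
def g0 {ι B X Pl : Type*} [DecidableEq ι] [DecidableEq Pl] (πΛX : Finset ι) (SpDom : Finset Pl) (πOut : Finset ι)
    (βX : Finset B) (ξX : Finset X) (PlOut : Finset Pl) (XOut : Finset X) (Firr Frel Fp : ι → ℂ) (Wb : B → ℂ) (Vx : X → ℂ)
    (W0 : Pl → ℝ) (e₀ : ℝ) (wil : Pl → ℝ) (P0site : X → ℝ) : ℂ :=
  ∑ Sπ ∈ πΛX.powerset, ∑ Sp ∈ SpDom.powerset,
    (∏ i ∈ Sπ, Firr i) * (∏ i ∈ πΛX \ Sπ, Frel i) * (∏ i ∈ πOut, Fp i) * (∏ b ∈ βX, Wb b) * (∏ x ∈ ξX, Vx x) *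
      ((∏ p ∈ Sp, (Real.exp (-W0 p) - 1)) *
        Real.exp (-(∑ p ∈ PlOut, e₀⁻¹ ^ 2 * wil p) - ∑ x ∈ XOut, P0site x) : ℝ)

/-- The inner `S_p`-sum of (3.20) is the Mayer expansion (3.19) of `exp[−Σ_{p∈Λ₀**∩X_ω**} W₀(p)]`
(`BIJ88Sect3Statements.mayer_319`). [cite: BalabanImbrieJaffe1988, (3.20) p.268] -/
theorem sum_Sp_eq_exp {Pl : Type*} [DecidableEq Pl] (SpDom : Finset Pl) (W0 : Pl → ℝ) :
    ∑ Sp ∈ SpDom.powerset, ∏ p ∈ Sp, (Real.exp (-W0 p) - 1) = Real.exp (-∑ p ∈ SpDom, W0 p) :=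
  (BIJ88Sect3Statements.mayer_319 SpDom W0).symm

/-! ## (3.38)–(3.41): the small-field integral, its polymer form, the resummation and the perturbative effective action -/

/-- **(3.38)** p. 271 [PDF 15], verbatim: *"The result is a small-field integral of the following form: ∫dμ^{(0)}_{Λ₁₀^{(0)}}(A^{(0)″},
φ^{(0)″}) χ′_{Λ₇^{(0)}} Π_{σ₁} F^{m̄}_{0,loc}(X_{σ₁}) exp[−V^{(0)}(Λ₈^{(0)}, u₁, A^{(0)}, φ^{(0)}) − Σ_X W₅^{(0)}(X)]. (3.38) Here A^{(0)″},
φ^{(0)″} are the translated fields"* — over an abstract configuration space `Ω` of the translated small fields carrying the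
conditioned Gaussian measure `μ = dμ^{(0)}_{Λ₁₀}` (data), the characteristic function `χ′`, the truncated local observable factors
`Fm σ`, the interaction `V` and the random-walk terms `W5 X` as functions on `Ω`. [cite: BalabanImbrieJaffe1988, (3.38) p.271] -/
def smallFieldIntegral338 {Ω σ ξ : Type*} [MeasurableSpace Ω] [Fintype σ] [Fintype ξ] (μ : Measure Ω) (χ' : Ω → ℝ)
    (Fm : σ → Ω → ℂ) (V : Ω → ℝ) (W5 : ξ → Ω → ℝ) : ℂ :=
  ∫ ω, (χ' ω : ℂ) * (∏ s, Fm s ω) * (Real.exp (-V ω - ∑ X, W5 X ω) : ℂ) ∂μ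

/-- **(3.39)** p. 272 [PDF 16], verbatim: *"The cluster expansion puts the integral (3.38) in polymer form, e^{−V^{(0)}_{const}(Λ₈^{(0)})}
Σ_{{X_α}} Π_α g₂(X_α). (3.39) The polymer functions g₂ depend only on fields in X_α, and exhibit exponential decay in |X_α|."* —
over the admissible collections `{X_α}` of polymers (data `families`, each a finite set of polymers of type `α`) and the polymer
activities `g₂`. [cite: BalabanImbrieJaffe1988, (3.39) p.272] -/
def polymerForm339 {α : Type*} (Vconst : ℝ) (families : Finset (Finset α)) (g₂ : α → ℂ) : ℂ :=
  (Real.exp (-Vconst) : ℂ) * ∑ F ∈ families, ∏ X ∈ F, g₂ X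

/-- (3.39): the empty collection contributes the pure constant `e^{−V_const}`. [cite: BalabanImbrieJaffe1988, (3.39) p.272] -/
theorem polymerForm339_singleton_empty {α : Type*} (Vconst : ℝ) (g₂ : α → ℂ) :
    polymerForm339 Vconst {∅} g₂ = Real.exp (-Vconst) := by
  simp [polymerForm339]

/-- **(3.40)** p. 272 [PDF 16], verbatim: *"The resummed integral in Λ₁₂^{(0)} is written as z_F(Λ₁₂^{(0)}) = (z_F(Λ₁₂^{(0)})/z(Λ₁₂^{(0)}))
exp(log z(Λ₁₂^{(0)})). (3.40) The first factor is the expectation of the portion of the observable in Λ₁₂^{(0)} in the interacting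
fluctuation measure. The exponent is the effective action"* — PROVED for `z > 0` (real `z`, complex `z_F`).
[cite: BalabanImbrieJaffe1988, (3.40) p.272] -/
theorem eq340 (zF : ℂ) {z : ℝ} (hz : 0 < z) : zF = zF / z * Real.exp (Real.log z) := by
  rw [Real.exp_log hz, div_mul_cancel₀ zF (Complex.ofReal_ne_zero.2 hz.ne')]

/-- **(3.41)** (first display) p. 272 [PDF 16], verbatim: *"We interpolate the interaction V^{(0)} − V^{(0)}_{const} with a prefactor t. …
The perturbative part of the effective action is 𝒫̃₁(Λ₁₂^{(0)}) = Σ_{α=1}^{n̄} −(1/α!)(d^α/dt^α) log z_t(Λ₁₂^{(0)})|_{t=0}, (3.41)"* —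
over the interpolated partition function `t ↦ z_t` (data `zt : ℝ → ℝ`). [cite: BalabanImbrieJaffe1988, (3.41) p.272] -/
def Ptilde1 (nbar : ℕ) (zt : ℝ → ℝ) : ℝ :=
  ∑ α ∈ Finset.Icc 1 nbar, -(1 / (α.factorial : ℝ)) * iteratedDeriv α (fun t => Real.log (zt t)) 0

/-- (3.41) at `n̄ = 0`: no perturbative terms. [cite: BalabanImbrieJaffe1988, (3.41) p.272] -/
theorem Ptilde1_zero (zt : ℝ → ℝ) : Ptilde1 0 zt = 0 := by
  simp [Ptilde1]

/-- **(3.41)** (second display) p. 272 [PDF 16], verbatim: *"As a result of these changes we have V^{(0)}_{const}(Λ₈^{(0)}) + 𝒫̃₁(Λ₁₂^{(0)})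
= 𝒫^L_{1,loc}(Λ₈^{(0)}) + Σ_X W₆^{(0)″}(X). (3.41)"* — the display DEFINES the irrelevant remainder `Σ_X W₆^{(0)″}(X)` (p. 272: *"the
remainder is expressed as Σ_X W₆^{(0)′}(X), a sum of localized, irrelevant terms"*) once the local perturbative action `𝒫^L_{1,loc}` is
fixed. [cite: BalabanImbrieJaffe1988, (3.41) p.272] -/
def W6rem (Vconst Pt1 PL1loc : ℝ) : ℝ := Vconst + Pt1 - PL1loc

/-- (3.41)(ii) as displayed. [cite: BalabanImbrieJaffe1988, (3.41) p.272] -/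
theorem eq341 (Vconst Pt1 PL1loc : ℝ) : Vconst + Pt1 = PL1loc + W6rem Vconst Pt1 PL1loc := by
  simp only [W6rem]
  ring

end

end Literature.MathematicalPhysics.QuantumFieldTheory.BalabanImbrieJaffe1984to88.BIJ88Sect3Expansion
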